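import Summits.NavierStokesRegularity.FunctionalMining.StretchingHolderBound
import HarnessLib

/-!
# FunctionalMining — the optimal static stretching constant `C_*` of K1-Q1 as a Lean object (dict seat, staged)

HONEST FRAMING. Search for candidate a priori estimates; no regularity claim. A STATIC object: nothing
about Navier–Stokes solutions is asserted. `stretchingSupConst := sInf {C | StretchingSupBound C}` is the
optimal constant `C_*` of the K0 row `E.q=2|T_C|C1` (DICTIONARY §14 row D2a, question K1-Q1). Proved
here, from tree theorems only: the valid set is a non-empty up-set (Hölder, `stretchingSupHolder_holds`,
p199336), `C_* ≤ 2/√3`, `C_*` is ATTAINED (`StretchingSupBound C_*`: a family of non-strict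
inequalities is closed under limits of the constant), an invalid constant lies below `C_*`, and
**`StretchingSupSharp ↔ C_* = 2/√3`**, **`¬StretchingSupSharp ↔ C_* < 2/√3`**. The no-go seat's
paper-level Theorem K1 (`pub-nsfunc-nogo/K1Q1.md`, [ours, UNREVIEWED]; K0-FLAGS v0.5 A6) asserts
`StretchingSupBound (2/√3 − η_K)` for any CZ₄ constant `K`, i.e. `C_* ≤ 2/√3 − η_K < 2/√3`; census
ascents give LOWER bounds for `C_*` (`le_stretchingSupConst`). The VALUE of `C_*` is the residual
K1-Q1 question. [ours; elementary order bookkeeping over Mathlib's conditionally complete lattice API]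
-/

noncomputable section

namespace Summit.NavierStokesRegularity.FunctionalMining

open Set Literature.Analysis.FunctionSpaces Literature.Analysis.FluidPDE

variable {d : Type*} [Fintype d] [DecidableEq d]

/-- The valid static stretching constants `{C | ∀ v, σ(v) ≤ C‖ω‖_∞ℰ(v)}`. [ours] -/
def stretchingSupValid : Set ℝ := {C | StretchingSupBound (d := d) C}

/-- **`C_*` of K1-Q1**: the infimum of the valid static stretching constants (Mathlib's junk value `0`
if the set were unbounded below; it is non-empty by Hölder). [ours] -/
def stretchingSupConst : ℝ := sInf (stretchingSupValid (d := d))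

/-- Membership in the valid set, unfolded. [ours] -/
theorem mem_stretchingSupValid {C : ℝ} :
    C ∈ stretchingSupValid (d := d) ↔ StretchingSupBound (d := d) C := Iff.rfl

/-- Up-set. [ours] -/
theorem stretchingSupValid_of_le {C C' : ℝ} (h : C ∈ stretchingSupValid (d := d)) (hCC' : C ≤ C') :
    C' ∈ stretchingSupValid (d := d) :=
  StretchingSupBound.mono h hCC'

/-- Non-empty: Hölder's `2/√3` is valid (tree, p199336). [ours] -/
theorem stretchingSupValid_nonempty : (stretchingSupValid (d := d)).Nonempty :=
  ⟨2 / Real.sqrt 3, stretchingSupHolder_holds (d := d)⟩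

/-- An invalid constant is a lower bound of the valid set. [ours] -/
theorem mem_lowerBounds_stretchingSupValid {C : ℝ} (h : ¬ StretchingSupBound (d := d) C) :
    C ∈ lowerBounds (stretchingSupValid (d := d)) := by
  intro C' hC'
  by_contra hlt
  exact h (stretchingSupValid_of_le hC' (not_le.mp hlt).le)

/-- One invalid constant bounds the valid set below. [ours] -/
theorem bddBelow_stretchingSupValid {C : ℝ} (h : ¬ StretchingSupBound (d := d) C) :
    BddBelow (stretchingSupValid (d := d)) :=
  ⟨C, mem_lowerBounds_stretchingSupValid h⟩

/-- A valid constant bounds `C_*` from above (given one invalid constant, i.e. boundedness below). [ours] -/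
theorem stretchingSupConst_le {C : ℝ} (hB : BddBelow (stretchingSupValid (d := d)))
    (h : StretchingSupBound (d := d) C) : stretchingSupConst (d := d) ≤ C :=
  csInf_le hB h

/-- **Census reading**: an invalid constant (a field violating the bound with constant `C`) bounds `C_*`
from below. [ours] -/
theorem le_stretchingSupConst {C : ℝ} (h : ¬ StretchingSupBound (d := d) C) :
    C ≤ stretchingSupConst (d := d) :=
  le_csInf stretchingSupValid_nonempty (mem_lowerBounds_stretchingSupValid h)

/-- **`C_* ≤ 2/√3`** (Hölder; unconditional). [ours] -/
theorem stretchingSupConst_le_holder : stretchingSupConst (d := d) ≤ 2 / Real.sqrt 3 := by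
  by_cases hB : BddBelow (stretchingSupValid (d := d))
  · exact csInf_le hB (stretchingSupHolder_holds (d := d))
  · rw [stretchingSupConst, Real.sInf_of_not_bddBelow hB]
    positivity

/-- **`C_*` is attained**: `StretchingSupBound C_*`. [ours] -/
theorem stretchingSupBound_const : StretchingSupBound (d := d) (stretchingSupConst (d := d)) := by
  intro hd v hv hdiv M hM hω
  obtain ⟨X, hX, hXdef⟩ : ∃ X : ℝ, 0 ≤ X ∧ X = M * torusEnstrophy v :=
    ⟨_, mul_nonneg hM (torusEnstrophy_nonneg v), rfl⟩
  have hval : ∀ C' ∈ stretchingSupValid (d := d), enstrophyProduction v ≤ C' * X := by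
    intro C' hC'
    have h' := hC' hd v hv hdiv M hM hω
    rw [hXdef, ← mul_assoc]; exact h'
  have goal : enstrophyProduction v ≤ stretchingSupConst (d := d) * X := by
    refine le_of_forall_pos_le_add fun ε hε => ?_
    rcases hX.eq_or_lt with hX0 | hXpos
    · obtain ⟨C', hC'⟩ := stretchingSupValid_nonempty (d := d)
      have h' := hval C' hC'
      rw [← hX0, mul_zero] at h'
      rw [← hX0, mul_zero, zero_add]
      exact h'.trans hε.le
    · have hXne : X ≠ 0 := hXpos.ne'
      obtain ⟨C', hC'mem, hC'lt⟩ := exists_lt_of_csInf_lt (stretchingSupValid_nonempty (d := d))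
        (lt_add_of_pos_right (stretchingSupConst (d := d)) (div_pos hε hXpos))
      have h1 := hval C' hC'mem
      have h2 : C' * X ≤ (stretchingSupConst (d := d) + ε / X) * X :=
        mul_le_mul_of_nonneg_right hC'lt.le hX
      have h3 : (stretchingSupConst (d := d) + ε / X) * X = stretchingSupConst (d := d) * X + ε := by
        rw [add_mul, div_mul_cancel₀ ε hXne]
      linarith
  rw [hXdef, ← mul_assoc] at goal
  exact goal

/-- **K1-Q1 in terms of `C_*`**: `StretchingSupSharp ↔ C_* = 2/√3`. [ours] -/
theorem stretchingSupSharp_iff :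
    StretchingSupSharp (d := d) ↔ stretchingSupConst (d := d) = 2 / Real.sqrt 3 := by
  constructor
  · intro h
    exact le_antisymm stretchingSupConst_le_holder
      (le_csInf stretchingSupValid_nonempty fun C hC => h C hC)
  · intro h C hC
    by_contra hlt
    have hlt' : C < 2 / Real.sqrt 3 := not_le.mp hlt
    by_cases hB : BddBelow (stretchingSupValid (d := d))
    · have h1 : stretchingSupConst (d := d) ≤ C := csInf_le hB hC
      linarith
    · have h0 : stretchingSupConst (d := d) = 0 := by
        rw [stretchingSupConst, Real.sInf_of_not_bddBelow hB]
      have hpos : (0 : ℝ) < 2 / Real.sqrt 3 := by positivity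
      linarith

/-- **`¬StretchingSupSharp ↔ C_* < 2/√3`** — the form in which the no-go seat's paper-level Theorem K1
(`C_* ≤ 2/√3 − η_K`) decides K1-Q1 once filed. [ours] -/
theorem not_stretchingSupSharp_iff :
    ¬ StretchingSupSharp (d := d) ↔ stretchingSupConst (d := d) < 2 / Real.sqrt 3 := by
  rw [stretchingSupSharp_iff]
  exact ⟨fun h => lt_of_le_of_ne stretchingSupConst_le_holder h, fun h => h.ne⟩

/-- Any explicit improvement of Hölder's constant decides K1-Q1 negatively. [ours] -/
theorem not_stretchingSupSharp_of_bound {C : ℝ} (hC : C < 2 / Real.sqrt 3)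
    (h : StretchingSupBound (d := d) C) : ¬ StretchingSupSharp (d := d) :=
  fun hs => absurd (hs C h) (not_le.mpr hC)

end Summit.NavierStokesRegularity.FunctionalMining

end
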